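import Summits.QuantumFields.BalabanUV.T4Continuum.Support.CovariantMeanLatticeDisc
import Literature.MathematicalPhysics.QuantumFieldTheory.Balaban1983to89.B14Radii

/-!
# `T4Continuum.CovariantMeanLatticeDepth` (cell-tree module `Summits/QuantumFields/BalabanUV/T4Continuum/Support/CovariantMeanLatticeDepth.lean`)
# — road P4 of the spine estimate NE1′, tangent-map formulation (v2): the DEPTH LEMMA L8-DL in the letters of the road —
# §1 the dictionary arithmetic over the typed printed radii `…Balaban1983to89.B14Radii`: the birth radius `a` of the
# scale-`i` space in fine-plaquette units is its innermost (2.34)-radius `α_{0,i}/(Lⁱ)²` (`rad234_innermost`), the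
# innermost scale-`j` radius is `θ·a` with the RELATIVE DEPTH `θ = (α_{0,j}/α_{0,i})·L^{−2(j−i)}` (`rad234_innermost_nesting`),
# under a comparability HYPOTHESIS SHAPE on the coefficients `θ ≤ (1+β₀)²/L²` from one level on (`depthRatio_le_of_one_le`),
# and the numeric side conditions N2′ (`16K²a < 1`) and support size (`K·a < 2ρ`) translate the axial-gauge letter `K`
# (`β ≤ K·δ`) into the hypotheses of the lattice gain; §2 the assembly with `CovariantMeanLatticeDisc.depth_gain_lattice_deep`:
# `‖Φ(exp B)‖ ≤ 2θ·N`; §0 the OFFSET form (no flatness-zero hypothesis: `‖Φ(exp B)‖ ≤ ‖Φ 1‖ + 2N/Λ`) for functionals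
# that are only approximately local
# (cell `pub-balaban`, sub-cell `t4`, ROUND-2 prover seat #4 of BINDER-OWNERS row NE1′, unit `b2b-balaban-t4-ne1p-p4`,
# generation 3; companion of the HOME record `t4/b2b-balaban-t4-ne1p-p4/PROPAGATION-v2.md` §2.4, §4.3, §4.5 and of the
# skeleton `t4/skeletons/NE1p-t4-ne1p-p4.md` leaf L8-DL, formalisable-now item (f7′); ADDITIVE — imports its sibling
# `Support.CovariantMeanLatticeDisc` and `…Balaban1983to89.B14Radii` only; nothing modified)

HONEST FRAMING.  Finite four-torus, rung (B)+1 only.  NOT infinite volume, NOT a mass gap, NOT the Clay problem, NOT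
summit progress.  HONEST DEPENDENCY: continuum YM on T⁴ ⇐ BetaPertH ∧ nine spine estimates (0/9 proved); BetaPertH ⇐
(D1) ∧ (D4) ∧ CAP+tail; G-an2-4 gates asym, D1 and NE2/3/4.  This module is real arithmetic plus one application of the
sibling's gain theorem; it asserts nothing about T. Bałaban's densities or spaces; every declaration is [folklore] and
sorry-free.  The typed radii of `…B14Radii` are USED AS REAL-VALUED FUNCTIONS of the printed letters (no printed
statement is asserted by using them); the comparability of the coefficients across scales (the printed (2.6)–(2.7)-type
growth) enters ONLY as the hypothesis `hcomp`, asserted for nothing.  The residues (r1)–(r4) of the sibling's header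
(containment hypothesis shape, axial gauge only through the letter `K`, flatness-zero as a hypothesis, linear ambient
space) apply verbatim.

CITATION HEADER (lean-in-tree rule).  No page of the series (CMP 1983–89) or of any other source is quoted or
attributed here; the printed (2.34)/(2.28)/(2.6)–(2.7) of [Balaban1988Convergent] are quoted in the imported
`…B14Radii` header.  Objects re-used BY NAME: `…B14Radii.rad234` / `rad234_eq` / `shrink_zero`,
`CovariantMeanLatticeDisc.depth_gain_lattice_deep` / `mapsTo_disc` / `differentiable_disc` (this seat),
`CovariantMeanRecursion.norm_le_div_of_disc` (this seat, p209931).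

REVISION v1.1 (additive; every v1 declaration byte-identical, v1 = p211631): §3 `exp_mem_of_containsSmall`,
`depth_gain_lattice_three_regime`, `third_member_lt_of_quad`, `depth_gain_of_scale_regularity_noN2` — adopted verbatim from the
XREAD probe of C-rgcontrg7-1 (seat `b2b-balaban-t4-ne1p-ideate-rg-contraction`, gen 7); no new import.
-/

noncomputable section

open NormedSpace Set Metric

namespace Summit.QuantumFields.BalabanUV.T4Continuum.CovariantMeanLatticeDepth

open CovariantMeanLatticeDisc (discHol ContainsSmall depth_gain_lattice_deep)

/-! ## §0 The offset form of the gain: a disc whose base value is small but not zero -/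

section Offset

variable {E F : Type*} [NormedAddCommGroup E] [NormedSpace ℂ E] [NormedAddCommGroup F] [NormedSpace ℂ F]

/-- SCHWARZ WITH A BASE VALUE: `Φ` differentiable and bounded by `N` on an open `S`, `ψ` an entire disc mapping the ball
of radius `Λ > 1` into `S`; then `‖Φ(ψ 1)‖ ≤ ‖Φ(ψ 0)‖ + 2N/Λ` (apply the disc lemma to `Φ − Φ(ψ 0)`, bounded by `2N`).
On the road: a functional that is only APPROXIMATELY local vanishes at a locally pure-gauge configuration only up to
a decay tail — the tail enters additively, the depth gain survives. [folklore] -/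
theorem norm_le_offset_of_disc {Φ : E → F} {S : Set E} {ψ : ℂ → E} {Λ N : ℝ} (hΛ : 1 < Λ) (hS : IsOpen S)
    (hΦ : DifferentiableOn ℂ Φ S) (hN : ∀ V ∈ S, ‖Φ V‖ ≤ N) (hψ : Differentiable ℂ ψ)
    (hmaps : MapsTo ψ (ball 0 Λ) S) : ‖Φ (ψ 1)‖ ≤ ‖Φ (ψ 0)‖ + 2 * N / Λ := by
  have h0S : ψ 0 ∈ S := hmaps (by rw [mem_ball, dist_self]; linarith)
  have hΦ' : DifferentiableOn ℂ (fun V => Φ V - Φ (ψ 0)) S := hΦ.sub_const _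
  have hN' : ∀ V ∈ S, ‖(fun V => Φ V - Φ (ψ 0)) V‖ ≤ 2 * N := by
    intro V hV
    calc ‖Φ V - Φ (ψ 0)‖ ≤ ‖Φ V‖ + ‖Φ (ψ 0)‖ := norm_sub_le _ _
      _ ≤ N + N := add_le_add (hN V hV) (hN _ h0S)
      _ = 2 * N := by ring
  have h00 : (fun V => Φ V - Φ (ψ 0)) (ψ 0) = 0 := by simp
  have h := CovariantMeanRecursion.norm_le_div_of_disc hΛ hS hΦ' hN' hψ hmaps h00
  have htri : ‖Φ (ψ 1)‖ ≤ ‖Φ (ψ 1) - Φ (ψ 0)‖ + ‖Φ (ψ 0)‖ := by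
    have e : Φ (ψ 1) = (Φ (ψ 1) - Φ (ψ 0)) + Φ (ψ 0) := by abel
    conv_lhs => rw [e]
    exact norm_add_le _ _
  have h' : ‖Φ (ψ 1) - Φ (ψ 0)‖ ≤ 2 * N / Λ := h
  linarith

end Offset

section OffsetLattice

variable {𝔅 : Type*} [Fintype 𝔅] {𝔸 : Type*} [NormedRing 𝔸] [NormedAlgebra ℂ 𝔸] [CompleteSpace 𝔸]
  {F : Type*} [NormedAddCommGroup F] [NormedSpace ℂ F]

open CovariantMeanLatticeDisc (disc disc_zero disc_one differentiable_disc mapsTo_disc)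

/-- **THE LATTICE DEPTH GAIN WITHOUT EXACT FLATNESS-ZERO (offset form).**  As `depth_gain_lattice`, but with no
hypothesis at the trivial configuration: `‖Φ(exp B)‖ ≤ ‖Φ 1‖ + 2N/Λ`.  For an approximately local covariant
functional `‖Φ 1‖` is its non-locality tail at a configuration pure gauge on the localization domain. [folklore] -/
theorem depth_gain_lattice_offset {S : Set (𝔅 → 𝔸)} {plaqs : Set (𝔅 × 𝔅 × 𝔅 × 𝔅)} {a ρ N : ℝ}
    {Φ : (𝔅 → 𝔸) → F} (hSo : IsOpen S) (hS : ContainsSmall S plaqs a ρ) (hΦ : DifferentiableOn ℂ Φ S)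
    (hN : ∀ V ∈ S, ‖Φ V‖ ≤ N) {B : 𝔅 → 𝔸} {β δ Λ : ℝ} (hβ0 : 0 ≤ β) (hβ : ∀ b, ‖B b‖ ≤ β)
    (hδ : ∀ p ∈ plaqs, ‖discHol B p 1 - 1‖ ≤ δ) (hΛ : 1 < Λ) (h4 : 4 * Λ * β ≤ 1)
    (ha : Λ * δ + 32 * Λ ^ 2 * β ^ 2 < a) (hρ : Λ * β < ρ) :
    ‖Φ (fun b => exp (B b))‖ ≤ ‖Φ 1‖ + 2 * N / Λ := by
  have hmaps := mapsTo_disc hS hβ0 hβ hδ hΛ.le h4 ha hρ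
  have h := norm_le_offset_of_disc hΛ hSo hΦ hN (differentiable_disc B) hmaps
  rwa [disc_one, disc_zero] at h

end OffsetLattice

/-! ## §1 Dictionary arithmetic: the letters `a`, `θ`, `β`, `K` against the typed printed radii `…B14Radii` -/

section Dictionary

open Literature.MathematicalPhysics.QuantumFieldTheory.Balaban1983to89.B14Radii (rad234 rad234_eq shrink_zero)

/-- THE BIRTH RADIUS in fine-plaquette units: the (2.34)-radius of the scale-`i` space at its innermost layer `n = i`
is `α_{0,i}/(Lⁱ)²` (the factor `shrink β 0 = 1`, the letter `ξ` cancels — `B14Radii.rad234_eq`). [folklore] -/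
theorem rad234_innermost {βB α0 ξ L : ℝ} (hξ : ξ ≠ 0) (hL : L ≠ 0) (i : ℕ) :
    rad234 βB α0 ξ L i i = α0 / (L ^ i) ^ 2 := by
  rw [rad234_eq hξ hL, Nat.sub_self, shrink_zero, one_mul]

/-- THE RELATIVE DEPTH of the scale-`j` space inside the scale-`i` space (innermost layers):
`θ = (α_{0,j}/α_{0,i})·L^{−2(j−i)}`. [folklore] -/
def depthRatio (α0i α0j L : ℝ) (i j : ℕ) : ℝ := (α0j / α0i) / (L ^ (j - i)) ^ 2

/-- NESTING: the innermost scale-`j` radius is `θ` times the innermost scale-`i` radius (`i ≤ j`). [folklore] -/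
theorem rad234_innermost_nesting {βB α0i α0j ξ L : ℝ} (hξ : ξ ≠ 0) (hL : L ≠ 0) (hα : α0i ≠ 0) {i j : ℕ}
    (hij : i ≤ j) : rad234 βB α0j ξ L j j = depthRatio α0i α0j L i j * rad234 βB α0i ξ L i i := by
  rw [rad234_innermost hξ hL, rad234_innermost hξ hL, depthRatio]
  obtain ⟨s, rfl⟩ := Nat.exists_eq_add_of_le hij
  rw [Nat.add_sub_cancel_left, pow_add]
  have hLi : L ^ i ≠ 0 := pow_ne_zero _ hL
  have hLs : L ^ s ≠ 0 := pow_ne_zero _ hL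
  field_simp

/-- … hence a configuration regular at scale `j` near the attachment point (plaquette deviation `δ` below the innermost
scale-`j` radius) sits at relative depth `θ` inside the scale-`i` birth space: `δ ≤ θ·a` with `a` the innermost
scale-`i` radius — the hypothesis `hδθ` of `depth_gain_lattice_deep`. [folklore] -/
theorem depth_of_regular {βB α0i α0j ξ L δ : ℝ} (hξ : ξ ≠ 0) (hL : L ≠ 0) (hα : α0i ≠ 0) {i j : ℕ} (hij : i ≤ j)
    (hδ : δ < rad234 βB α0j ξ L j j) : δ ≤ depthRatio α0i α0j L i j * rad234 βB α0i ξ L i i := by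
  rw [← rad234_innermost_nesting hξ hL hα hij]; exact hδ.le

/-- COMPARABILITY OF THE COEFFICIENTS ACROSS SCALES as a HYPOTHESIS SHAPE (the printed (2.6)–(2.7)-type growth
`α_{0,j} ≤ (1+β₀)²·√(j−i)·α_{0,i}` is NOT asserted): under it `θ ≤ (1+β₀)²√(j−i)·L^{−2(j−i)}`. [folklore] -/
theorem depthRatio_le_of_comparable {α0i α0j L β₀ : ℝ} (hα : 0 < α0i) (hL : 0 < L) {i j : ℕ}
    (hcomp : α0j ≤ (1 + β₀) ^ 2 * Real.sqrt ((j - i : ℕ) : ℝ) * α0i) :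
    depthRatio α0i α0j L i j ≤ (1 + β₀) ^ 2 * Real.sqrt ((j - i : ℕ) : ℝ) / (L ^ (j - i)) ^ 2 := by
  unfold depthRatio
  have hLs : 0 < (L ^ (j - i)) ^ 2 := by positivity
  rw [div_le_div_iff_of_pos_right hLs, div_le_iff₀ hα]
  exact hcomp

/-- `t + 1 ≤ 4ᵗ`. [folklore] -/
theorem succ_le_four_pow (t : ℕ) : ((t : ℝ) + 1) ≤ (4 : ℝ) ^ t := by
  induction t with
  | zero => simp
  | succ n ih =>
      rw [pow_succ]; push_cast; nlinarith [pow_pos (by norm_num : (0:ℝ) < 4) n]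

/-- `√s ≤ 4^{s−1}` for `s ≥ 1`, hence `√s ≤ (L²)^{s−1}` for `L ≥ 2`. [folklore] -/
theorem sqrt_le_pow {L : ℝ} (hL : 2 ≤ L) {s : ℕ} (hs : 1 ≤ s) : Real.sqrt (s : ℝ) ≤ (L ^ 2) ^ (s - 1) := by
  have hs' : Real.sqrt (s : ℝ) ≤ (s : ℝ) := by
    rw [Real.sqrt_le_left (by positivity)]
    have : (1 : ℝ) ≤ s := by exact_mod_cast hs
    nlinarith
  have h4 : (s : ℝ) ≤ (4 : ℝ) ^ (s - 1) := by
    obtain ⟨t, rfl⟩ := Nat.exists_eq_add_of_le hs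
    rw [Nat.add_sub_cancel_left]
    have := succ_le_four_pow t
    push_cast; linarith
  have hL4 : (4 : ℝ) ^ (s - 1) ≤ (L ^ 2) ^ (s - 1) := by
    apply pow_le_pow_left₀ (by norm_num)
    nlinarith
  exact hs'.trans (h4.trans hL4)

/-- THE DEPTH IS SMALL FROM ONE LEVEL ON: under the comparability shape, for `j − i ≥ 1`, `L ≥ 2`:
`θ ≤ (1+β₀)²/L²` — so `θ < 1/2` (the hypothesis `hθ` of the gain theorems) as soon as `2(1+β₀)² < L²`. [folklore] -/
theorem depthRatio_le_of_one_le {α0i α0j L β₀ : ℝ} (hα : 0 < α0i) (hL : 2 ≤ L) {i j : ℕ} (hs : 1 ≤ j - i)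
    (hcomp : α0j ≤ (1 + β₀) ^ 2 * Real.sqrt ((j - i : ℕ) : ℝ) * α0i) :
    depthRatio α0i α0j L i j ≤ (1 + β₀) ^ 2 / L ^ 2 := by
  have hL0 : 0 < L := by linarith
  have h := depthRatio_le_of_comparable hα hL0 hcomp
  have hsq := sqrt_le_pow hL hs
  set s := j - i with hs_def
  have hLs : 0 < (L ^ s) ^ 2 := by positivity
  have hL2 : 0 < L ^ 2 := by positivity
  refine h.trans ?_
  rw [div_le_div_iff₀ hLs hL2]
  have e : (L ^ s) ^ 2 = L ^ 2 * (L ^ 2) ^ (s - 1) := by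
    obtain ⟨t, ht⟩ := Nat.exists_eq_add_of_le hs
    rw [ht, Nat.add_sub_cancel_left]; ring
  rw [e]
  have h0 : 0 ≤ (1 + β₀) ^ 2 := sq_nonneg _
  calc (1 + β₀) ^ 2 * Real.sqrt (s : ℝ) * L ^ 2 = (1 + β₀) ^ 2 * L ^ 2 * Real.sqrt (s : ℝ) := by ring
    _ ≤ (1 + β₀) ^ 2 * L ^ 2 * (L ^ 2) ^ (s - 1) := mul_le_mul_of_nonneg_left hsq (by positivity)
    _ = (1 + β₀) ^ 2 * (L ^ 2 * (L ^ 2) ^ (s - 1)) := by ring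

/-- `θ < 1/2` under the comparability shape when `j − i ≥ 1`, `L ≥ 2` and `2(1+β₀)² < L²`. [folklore] -/
theorem depthRatio_lt_half {α0i α0j L β₀ : ℝ} (hα : 0 < α0i) (hL : 2 ≤ L) {i j : ℕ} (hs : 1 ≤ j - i)
    (hcomp : α0j ≤ (1 + β₀) ^ 2 * Real.sqrt ((j - i : ℕ) : ℝ) * α0i) (hLβ : 2 * (1 + β₀) ^ 2 < L ^ 2) :
    depthRatio α0i α0j L i j < 1 / 2 := by
  have h := depthRatio_le_of_one_le hα hL hs hcomp
  have hL2 : 0 < L ^ 2 := by positivity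
  refine lt_of_le_of_lt h ?_
  rw [div_lt_iff₀ hL2]; linarith

/-- THE NUMERIC SIDE CONDITION N2′ in the letters of the road: potentials from the axial gauge `β ≤ K·δ` (`K` the
Poincaré constant of the localization domain, (r2)), depth `δ ≤ θ·a`, and `16K²·a < 1` give the quadratic hypothesis
`16β² < θ²a` of the gain theorems. [folklore] -/
theorem quad_of_axial {K β δ θ a : ℝ} (hK : 0 ≤ K) (hβ0 : 0 ≤ β) (hβ : β ≤ K * δ)
    (hδ : δ ≤ θ * a) (hθ : 0 < θ) (ha : 0 < a) (hN2 : 16 * K ^ 2 * a < 1) : 16 * β ^ 2 < θ ^ 2 * a := by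
  have h1 : β ≤ K * (θ * a) := hβ.trans (mul_le_mul_of_nonneg_left hδ hK)
  have h2 : β ^ 2 ≤ (K * (θ * a)) ^ 2 := pow_le_pow_left₀ hβ0 h1 2
  have h3 : 16 * (K * (θ * a)) ^ 2 = (16 * K ^ 2 * a) * (θ ^ 2 * a) := by ring
  have h4 : (16 * K ^ 2 * a) * (θ ^ 2 * a) < 1 * (θ ^ 2 * a) :=
    mul_lt_mul_of_pos_right hN2 (by positivity)
  nlinarith

/-- THE SUPPORT-SIZE CONDITION in the letters of the road: `β ≤ K·δ`, `δ ≤ θ·a` and `K·a < 2ρ` give the hypothesis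
`β < 2θρ` of `depth_gain_lattice_deep` (where it fails, `depth_gain_lattice_two_regime` applies). [folklore] -/
theorem supp_of_axial {K β δ θ a ρ : ℝ} (hK : 0 ≤ K) (hβ : β ≤ K * δ) (hδ : δ ≤ θ * a) (hθ : 0 < θ)
    (h : K * a < 2 * ρ) : β < 2 * θ * ρ := by
  have h1 : β ≤ K * (θ * a) := hβ.trans (mul_le_mul_of_nonneg_left hδ hK)
  have h2 : K * (θ * a) = θ * (K * a) := by ring
  have h3 : θ * (K * a) < θ * (2 * ρ) := mul_lt_mul_of_pos_left h hθ
  nlinarith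

end Dictionary

/-! ## §2 The depth lemma in the letters of the road (assembly) -/

section Assembly

variable {𝔅 : Type*} [Fintype 𝔅] {𝔸 : Type*} [NormedRing 𝔸] [NormedAlgebra ℂ 𝔸] [CompleteSpace 𝔸]
  {F : Type*} [NormedAddCommGroup F] [NormedSpace ℂ F]

/-- **L8-DL, LATTICE FORM.**  A functional `Φ` differentiable and bounded by `N` on an open domain containing the small
pure-potential configurations of radii `(a, ρ)` (the birth space, (r1)), vanishing at `1` ((r3)); a configuration in
axial gauge `exp B` with listed plaquettes within `δ ≤ θ·a` of `1` (regular at the deeper scale, relative depth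
`0 < θ < 1/2`) and potentials `‖B_b‖ ≤ β ≤ K·δ` ((r2)); numeric side conditions `16K²a < 1` (N2′) and `K·a < 2ρ`
(support size), `a ≤ 1`.  Then `‖Φ(exp B)‖ ≤ 2θ·N`. [folklore] -/
theorem depth_gain_of_scale_regularity {S : Set (𝔅 → 𝔸)} {plaqs : Set (𝔅 × 𝔅 × 𝔅 × 𝔅)} {a ρ N : ℝ}
    {Φ : (𝔅 → 𝔸) → F} (hSo : IsOpen S) (hS : ContainsSmall S plaqs a ρ) (hΦ : DifferentiableOn ℂ Φ S)
    (hN : ∀ V ∈ S, ‖Φ V‖ ≤ N) (h0 : Φ 1 = 0) {B : 𝔅 → 𝔸} {β δ θ K : ℝ} (hβ0 : 0 ≤ β)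
    (hβ : ∀ b, ‖B b‖ ≤ β) (hδ : ∀ p ∈ plaqs, ‖discHol B p 1 - 1‖ ≤ δ) (hθ0 : 0 < θ)
    (hθ : θ < 1 / 2) (ha0 : 0 < a) (ha1 : a ≤ 1) (hδθ : δ ≤ θ * a) (hK : 0 ≤ K) (hβK : β ≤ K * δ)
    (hN2 : 16 * K ^ 2 * a < 1) (hsupp : K * a < 2 * ρ) : ‖Φ (fun b => exp (B b))‖ ≤ 2 * θ * N :=
  depth_gain_lattice_deep hSo hS hΦ hN h0 hβ0 hβ hδ hθ0 hθ ha1 hδθ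
    (quad_of_axial hK hβ0 hβK hδθ hθ0 ha0 hN2) (supp_of_axial hK hβK hδθ hθ0 hsupp)

end Assembly

/-! ## §3 No numeric side condition: the three-regime form (v1.1 — ADOPTED VERBATIM, names kept, from the cross-read
probe `HOME/b2b-balaban-t4-ne1p-ideate-rg-contraction/xread/CovariantMeanLatticeProbe.lean` sha16 b337399eba19d521 of the
XREAD certificate C-rgcontrg7-1 (journal l.8724, seat `b2b-balaban-t4-ne1p-ideate-rg-contraction` gen 7), with thanks: the
quadratic side condition N2′ kept by `depth_gain_lattice_two_regime` is itself a diameter condition and can be DROPPED at the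
price of a third member `12β/√a`; in road letters the gain is then `θ·N·max(2, 2Ka/ρ, 12K√a)` with NO numeric side condition —
the kernel form of the skeleton's «else DL's max-form with the polynomial d(Y) factor») -/

section NoSideCondition

variable {𝔅 : Type*} [Fintype 𝔅] {𝔸 : Type*} [NormedRing 𝔸] [NormedAlgebra ℂ 𝔸] [CompleteSpace 𝔸]
  {F : Type*} [NormedAddCommGroup F] [NormedSpace ℂ F]

open CovariantMeanLatticeDisc (depth_gain_lattice one_mem_of_containsSmall)

omit [Fintype 𝔅] [CompleteSpace 𝔸] in
/-- THE ENDPOINT IS INSIDE: under `ContainsSmall S plaqs a ρ`, a configuration `exp B` with listed plaquettes within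
`δ < a` of `1` and potentials `≤ β < ρ` lies in `S` itself (the `ζ = 1` point of the disc; no radius needed). -/
theorem exp_mem_of_containsSmall {S : Set (𝔅 → 𝔸)} {plaqs : Set (𝔅 × 𝔅 × 𝔅 × 𝔅)} {a ρ : ℝ}
    (hS : ContainsSmall S plaqs a ρ) {B : 𝔅 → 𝔸} {β δ : ℝ} (hβ : ∀ b, ‖B b‖ ≤ β)
    (hδ : ∀ p ∈ plaqs, ‖discHol B p 1 - 1‖ ≤ δ) (hδa : δ < a) (hβρ : β < ρ) :
    (fun b => exp (B b)) ∈ S :=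
  hS B ⟨fun p hp => by
      have h := hδ p hp
      simp only [discHol, one_smul] at h
      exact lt_of_le_of_lt h hδa,
    fun b => lt_of_le_of_lt (hβ b) hβρ⟩

/-- **THE LATTICE DEPTH GAIN, THREE REGIMES — NO N2′.**  Hypotheses of `depth_gain_lattice_two_regime` MINUS the
quadratic side condition `hquad : 16β² < θ²a`, and otherwise WEAKER (`0 ≤ β`, `θ < 1`, `β < ρ`, plus `0 < a` which
`hquad` used to imply): then `‖Φ(exp B)‖ ≤ N·max(2θ, 2β/ρ, 12β/√a)`.  Proof: if the max is `≥ 1` the sup bound at the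
endpoint (which lies in `S`) already wins; else Schwarz along the disc with `Λ = 1/max`, where `Λδ ≤ a/2`,
`32Λ²β² ≤ 2a/9`, `4Λβ ≤ √a/3 ≤ 1/3`, `Λβ ≤ ρ/2` — `depth_gain_lattice` BY NAME.  On the road (`β ≤ Kδ ≤ Kθa`) the third
member is `12θ·K√a`, LINEAR in `K√a ∝ (d−1)·n_cubes·CM·√α_{0,i}`: the depth times a factor linear in the diameter, now
also when N2′ (`K√a < 1/4`) fails. [folklore] -/
theorem depth_gain_lattice_three_regime {S : Set (𝔅 → 𝔸)} {plaqs : Set (𝔅 × 𝔅 × 𝔅 × 𝔅)} {a ρ N : ℝ}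
    {Φ : (𝔅 → 𝔸) → F} (hSo : IsOpen S) (hS : ContainsSmall S plaqs a ρ) (hΦ : DifferentiableOn ℂ Φ S)
    (hN : ∀ V ∈ S, ‖Φ V‖ ≤ N) (h0 : Φ 1 = 0) {B : 𝔅 → 𝔸} {β δ θ : ℝ} (hβ0 : 0 ≤ β) (hβ : ∀ b, ‖B b‖ ≤ β)
    (hδ : ∀ p ∈ plaqs, ‖discHol B p 1 - 1‖ ≤ δ) (hθ0 : 0 < θ) (hθ1 : θ < 1) (ha0 : 0 < a) (ha1 : a ≤ 1)
    (hδθ : δ ≤ θ * a) (hβρ : β < ρ) :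
    ‖Φ (fun b => exp (B b))‖ ≤ N * max (2 * θ) (max (2 * β / ρ) (12 * β / Real.sqrt a)) := by
  set M : ℝ := max (2 * θ) (max (2 * β / ρ) (12 * β / Real.sqrt a)) with hM_def
  have hρ0 : 0 < ρ := lt_of_le_of_lt hβ0 hβρ
  have hsa : 0 < Real.sqrt a := Real.sqrt_pos.mpr ha0
  have hsa1 : Real.sqrt a ≤ 1 := by rw [← Real.sqrt_one]; exact Real.sqrt_le_sqrt ha1
  have hM1 : 2 * θ ≤ M := le_max_left _ _
  have hM2 : 2 * β / ρ ≤ M := (le_max_left _ _).trans (le_max_right _ _)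
  have hM3 : 12 * β / Real.sqrt a ≤ M := (le_max_right _ _).trans (le_max_right _ _)
  have hM0 : 0 < M := lt_of_lt_of_le (by linarith) hM1
  have hθa : θ * a < 1 * a := mul_lt_mul_of_pos_right hθ1 ha0
  have hδa : δ < a := by linarith
  have hmem : (fun b => exp (B b)) ∈ S := exp_mem_of_containsSmall hS hβ hδ hδa hβρ
  have hN0 : 0 ≤ N := (norm_nonneg _).trans (hN _ hmem)
  rcases le_or_gt 1 M with hM | hM
  · -- trivial regime: the sup bound at the endpoint already beats `N·M`
    calc ‖Φ (fun b => exp (B b))‖ ≤ N := hN _ hmem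
      _ = N * 1 := (mul_one N).symm
      _ ≤ N * M := mul_le_mul_of_nonneg_left hM hN0
  · -- Schwarz regime, radius `Λ = 1/M > 1`
    set Λ : ℝ := 1 / M with hΛ_def
    have hΛ0 : 0 < Λ := by positivity
    have hΛ1 : 1 < Λ := by rw [hΛ_def, lt_div_iff₀ hM0]; linarith
    have hΛM : Λ * M = 1 := by rw [hΛ_def, one_div, inv_mul_cancel₀ hM0.ne']
    have hΛθ : Λ * θ ≤ 1 / 2 := by
      have h : Λ * (2 * θ) ≤ 1 := by
        calc Λ * (2 * θ) ≤ Λ * M := mul_le_mul_of_nonneg_left hM1 hΛ0.le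
          _ = 1 := hΛM
      linarith
    have hΛβρ : Λ * β ≤ ρ / 2 := by
      have h : Λ * (2 * β / ρ) ≤ 1 := by
        calc Λ * (2 * β / ρ) ≤ Λ * M := mul_le_mul_of_nonneg_left hM2 hΛ0.le
          _ = 1 := hΛM
      have e : Λ * (2 * β / ρ) = (2 * (Λ * β)) / ρ := by ring
      rw [e, div_le_iff₀ hρ0] at h
      linarith
    have hΛβa : 12 * (Λ * β) ≤ Real.sqrt a := by
      have h : Λ * (12 * β / Real.sqrt a) ≤ 1 := by
        calc Λ * (12 * β / Real.sqrt a) ≤ Λ * M := mul_le_mul_of_nonneg_left hM3 hΛ0.le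
          _ = 1 := hΛM
      have e : Λ * (12 * β / Real.sqrt a) = (12 * (Λ * β)) / Real.sqrt a := by ring
      rw [e, div_le_iff₀ hsa] at h
      linarith
    have hΛβ0 : 0 ≤ Λ * β := mul_nonneg hΛ0.le hβ0
    have h4 : 4 * Λ * β ≤ 1 := by
      have : 4 * Λ * β = 4 * (Λ * β) := by ring
      rw [this]; linarith
    have ha : Λ * δ + 32 * Λ ^ 2 * β ^ 2 < a := by
      have e1 : Λ * δ ≤ a / 2 := by
        calc Λ * δ ≤ Λ * (θ * a) := mul_le_mul_of_nonneg_left hδθ hΛ0.le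
          _ = (Λ * θ) * a := by ring
          _ ≤ (1 / 2) * a := mul_le_mul_of_nonneg_right hΛθ ha0.le
          _ = a / 2 := by ring
      have e2 : 32 * Λ ^ 2 * β ^ 2 ≤ 2 * a / 9 := by
        have hsq : (12 * (Λ * β)) ^ 2 ≤ (Real.sqrt a) ^ 2 := pow_le_pow_left₀ (by positivity) hΛβa 2
        rw [Real.sq_sqrt ha0.le] at hsq
        nlinarith [hsq]
      linarith
    have hρ : Λ * β < ρ := by linarith
    have h := depth_gain_lattice hSo hS hΦ hN h0 hβ0 hβ hδ hΛ1 h4 ha hρ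
    calc ‖Φ (fun b => exp (B b))‖ ≤ N / Λ := h
      _ = N * M := by rw [hΛ_def, div_div_eq_mul_div, div_one]

/-- Consistency with the tree's regime: under `hquad` (`16β² < θ²a`) the third member is `< 3θ`, so in N2′'s own
regime the no-N2′ bound is within a factor `3/2` of `depth_gain_lattice_deep`'s `2θ·N`. [folklore] -/
theorem third_member_lt_of_quad {β θ a : ℝ} (hθ0 : 0 < θ) (ha0 : 0 < a)
    (hquad : 16 * β ^ 2 < θ ^ 2 * a) : 12 * β / Real.sqrt a < 3 * θ := by
  have hsa : 0 < Real.sqrt a := Real.sqrt_pos.mpr ha0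
  have hsq : (4 * β) ^ 2 < (θ * Real.sqrt a) ^ 2 := by
    rw [mul_pow, mul_pow, Real.sq_sqrt ha0.le]; linarith
  have h4 : 4 * β < θ * Real.sqrt a := lt_of_pow_lt_pow_left₀ 2 (by positivity) hsq
  rw [div_lt_iff₀ hsa]; linarith

/-- **L8-DL IN ROAD LETTERS WITH NO NUMERIC SIDE CONDITION** (neither N2′ `16K²a < 1` nor the support-size
`K·a < 2ρ`): potentials from the axial gauge `β ≤ K·δ`, depth `δ ≤ θ·a`, the configuration inside the space
(`β < ρ`); then `‖Φ(exp B)‖ ≤ θ·N·max(2, 2Ka/ρ, 12K√a)` — the relative depth `θ` times a factor LINEAR in the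
Poincaré letter `K ∝ diam`. [folklore] -/
theorem depth_gain_of_scale_regularity_noN2 {S : Set (𝔅 → 𝔸)} {plaqs : Set (𝔅 × 𝔅 × 𝔅 × 𝔅)} {a ρ N : ℝ}
    {Φ : (𝔅 → 𝔸) → F} (hSo : IsOpen S) (hS : ContainsSmall S plaqs a ρ) (hΦ : DifferentiableOn ℂ Φ S)
    (hN : ∀ V ∈ S, ‖Φ V‖ ≤ N) (h0 : Φ 1 = 0) {B : 𝔅 → 𝔸} {β δ θ K : ℝ} (hβ0 : 0 ≤ β)
    (hβ : ∀ b, ‖B b‖ ≤ β) (hδ : ∀ p ∈ plaqs, ‖discHol B p 1 - 1‖ ≤ δ) (hθ0 : 0 < θ) (hθ1 : θ < 1)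
    (ha0 : 0 < a) (ha1 : a ≤ 1) (hδθ : δ ≤ θ * a) (hK : 0 ≤ K) (hβK : β ≤ K * δ) (hβρ : β < ρ) :
    ‖Φ (fun b => exp (B b))‖ ≤ θ * N * max 2 (max (2 * K * a / ρ) (12 * K * Real.sqrt a)) := by
  have h := depth_gain_lattice_three_regime hSo hS hΦ hN h0 hβ0 hβ hδ hθ0 hθ1 ha0 ha1 hδθ hβρ
  have hρ0 : 0 < ρ := lt_of_le_of_lt hβ0 hβρ
  have hsa : 0 < Real.sqrt a := Real.sqrt_pos.mpr ha0
  have hβ' : β ≤ K * (θ * a) := hβK.trans (mul_le_mul_of_nonneg_left hδθ hK)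
  have hN0 : 0 ≤ N := by
    have := hN 1 (one_mem_of_containsSmall hS ha0 hρ0); rwa [h0, norm_zero] at this
  set P : ℝ := max 2 (max (2 * K * a / ρ) (12 * K * Real.sqrt a)) with hP_def
  have m1 : 2 * θ ≤ θ * P := by
    have h2 : (2 : ℝ) ≤ P := le_max_left _ _
    nlinarith [mul_le_mul_of_nonneg_left h2 hθ0.le]
  have m2 : 2 * β / ρ ≤ θ * P := by
    have hP : 2 * K * a / ρ ≤ P := (le_max_left _ _).trans (le_max_right _ _)
    calc 2 * β / ρ ≤ 2 * (K * (θ * a)) / ρ := (div_le_div_iff_of_pos_right hρ0).mpr (by linarith)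
      _ = θ * (2 * K * a / ρ) := by ring
      _ ≤ θ * P := mul_le_mul_of_nonneg_left hP hθ0.le
  have m3 : 12 * β / Real.sqrt a ≤ θ * P := by
    have hP : 12 * K * Real.sqrt a ≤ P := (le_max_right _ _).trans (le_max_right _ _)
    calc 12 * β / Real.sqrt a ≤ 12 * (K * (θ * a)) / Real.sqrt a :=
          (div_le_div_iff_of_pos_right hsa).mpr (by linarith)
      _ = θ * (12 * K * (a / Real.sqrt a)) := by ring
      _ = θ * (12 * K * Real.sqrt a) := by rw [Real.div_sqrt]
      _ ≤ θ * P := mul_le_mul_of_nonneg_left hP hθ0.le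
  have hmax : max (2 * θ) (max (2 * β / ρ) (12 * β / Real.sqrt a)) ≤ θ * P := max_le m1 (max_le m2 m3)
  calc ‖Φ (fun b => exp (B b))‖ ≤ N * max (2 * θ) (max (2 * β / ρ) (12 * β / Real.sqrt a)) := h
    _ ≤ N * (θ * P) := mul_le_mul_of_nonneg_left hmax hN0
    _ = θ * N * P := by ring

end NoSideCondition

end Summit.QuantumFields.BalabanUV.T4Continuum.CovariantMeanLatticeDepth

end
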